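import Summits.FinalStateConjecture.FinalStateConjecture.Theorems.ZeroEnergyKerrOrBombHawkingExtensionIsKerrLocalZerothLawTrace
import Summits.FinalStateConjecture.FinalStateConjecture.Theorems.ZeroEnergyKerrOrBombHawkingExtensionIsKerrLevelSetConstancy
import Summits.FinalStateConjecture.FinalStateConjecture.Theorems.ZeroEnergyKerrOrBombHawkingExtensionIsKerrHorizonLevelSet
import Summits.FinalStateConjecture.FinalStateConjecture.Theorems.ZeroEnergyKerrOrBombHawkingExtensionIsKerrRestrictTransport
import HarnessLib

/-!
# Crux `HawkingExtensionIsKerr` (stmt-FinalStateConjecture-17840), line `SketchIdeator2` —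
# collar zeroth law, assembly I: the surface gravity of the collar is locally constant on `𝓔⁺`

Helper file of the line lead (c3), programme "collar zeroth law".  For the Killing–timelike collar
`(U, K)` of the crux the candidate surface gravity `κ̃ = -g(∇_Y K, K) / g(K, Y)` (`collarKap`; `Y`
the time-orientation field) satisfies `∇_K K = κ̃ K` on `𝓔⁺` (step A) and is locally constant on
`𝓔⁺` at every horizon point where it does not vanish (`eventually_collarKap_eq_of_ne_zero`): read
everything on the open sub-carrier `U' = U ∩ I⁺(M_ext) ∩ {g(K, Y) ≠ 0}` (step D), where `K|U'` is a
global Killing field of the Ricci-flat `g|U'`; the infinitesimal zeroth law (step E4) gives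
`dκ̃ ∈ ℝ d(g(K,K))` at the horizon points near `p`, the horizon is the level set `{g(K,K) = 0}`
there (step B), and functions with proportional differentials are constant on a regular level set
(step G).  Bardeen–Carter–Hawking 1973, §3; Wald 1984, §12.5, (12.5.30)–(12.5.31).
-/

noncomputable section

set_option linter.dupNamespace false

namespace Summit.FinalStateConjecture.FinalStateConjecture.Theorems.HawkingExtensionIsKerr.SketchIdeator2

open Set Function Filter TopologicalSpace Bundle Literature.Geometry.Lorentzian
  Literature.Geometry.Manifold Literature.Geometry.Manifold.OpenSubmanifold
open scoped Manifold ContDiff Topology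

/-- The **candidate surface gravity of the collar**: `κ̃ = -g(∇_Y K, K) / g(K, Y)` with `Y` the
time-orientation field of `𝓑`.  At a horizon point where `∇_K K = κ K` (step A) the Killing equation
gives `κ = κ̃` (`leviCivita_self_eq_collarKap_smul`). Wald 1984, §12.5, (12.5.2)–(12.5.5). -/
def collarKap (𝓑 : StationaryAFBlackHole.{0}) [𝓑.metric.HasLeviCivita]
    (K : Π x : 𝓑.carrier, TangentSpace (𝓡 4) x) (y : 𝓑.carrier) : ℝ :=
  -(𝓑.metric.val y (𝓑.metric.leviCivita K y (𝓑.timeOrientation.vectorField y)) (K y)) /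
    𝓑.metric.val y (K y) (𝓑.timeOrientation.vectorField y)

section Local

variable (𝓑 : StationaryAFBlackHole.{0}) [𝓑.metric.HasLeviCivita]
  {U : Set 𝓑.carrier} {K : Π x : 𝓑.carrier, TangentSpace (𝓡 4) x}

omit [𝓑.metric.HasLeviCivita] in
/-- A null non-zero vector is not orthogonal to the (timelike) time orientation. [folklore] -/
theorem val_timeOrientation_ne_zero_of_null {p : 𝓑.carrier} {v : TangentSpace (𝓡 4) p}
    (hv : 𝓑.metric.val p v v = 0) (hv0 : v ≠ 0) :
    𝓑.metric.val p v (𝓑.timeOrientation.vectorField p) ≠ 0 := by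
  intro h0
  have hpos := 𝓑.metric.pos_of_orthogonal p (𝓑.timeOrientation.vectorField p) v
    (𝓑.timeOrientation.isTimelike p) (by rw [𝓑.metric.symm]; exact h0) hv0
  rw [hv] at hpos
  exact lt_irrefl _ hpos

/-- **Step A in `κ̃`-form.**  On the horizon of the collar, `∇_K K = κ̃ K` and
`g(∇_v K, K) = -κ̃ g(K, v)` for all `v`, with `κ̃ = collarKap 𝓑 K`. -/
theorem leviCivita_self_eq_collarKap_smul (hU : IsOpen U) (hHU : 𝓑.horizon ⊆ U)
    (hKon : 𝓑.metric.toPseudoRiemannianMetric.IsKillingFieldOn K U)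
    (hKne : ∀ p ∈ 𝓑.horizon, K p ≠ 0) (hnull : ∀ p ∈ 𝓑.horizon, 𝓑.metric.val p (K p) (K p) = 0)
    (hKtl : ∀ x ∈ U ∩ 𝓑.doc, 𝓑.metric.val x (K x) (K x) < 0) {p : 𝓑.carrier} (hp : p ∈ 𝓑.horizon) :
    𝓑.metric.leviCivita K p (K p) = collarKap 𝓑 K p • K p ∧
      ∀ v, 𝓑.metric.val p (𝓑.metric.leviCivita K p v) (K p) =
        -(collarKap 𝓑 K p) * 𝓑.metric.val p (K p) v := by
  obtain ⟨κ, hκ⟩ := collarSurfaceGravity_pointwise 𝓑 hU hHU hKon hnull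
    (fun x hx ↦ (hKtl x hx).le) p hp
  have hKY := val_timeOrientation_ne_zero_of_null 𝓑 (hnull p hp) (hKne p hp)
  have hKill := hKon.val_leviCivita_add (hHU hp) (𝓑.timeOrientation.vectorField p) (K p)
  rw [hκ, map_smul, smul_eq_mul] at hKill
  have hsym : 𝓑.metric.val p (𝓑.timeOrientation.vectorField p) (K p) =
      𝓑.metric.val p (K p) (𝓑.timeOrientation.vectorField p) := 𝓑.metric.symm p _ _
  rw [hsym] at hKill
  have hkap : collarKap 𝓑 K p = κ := by
    unfold collarKap
    field_simp
    linarith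
  refine ⟨by rw [hkap, hκ], fun v ↦ ?_⟩
  rw [hkap]
  have h1 := hKon.val_leviCivita_add (hHU hp) v (K p)
  rw [hκ, map_smul, smul_eq_mul, 𝓑.metric.symm p v (K p)] at h1
  linarith

/-- **`κ̃` is smooth where `K` is Killing and `g(K, Y) ≠ 0`.** -/
theorem contMDiffAt_collarKap (hU : IsOpen U)
    (hKon : 𝓑.metric.toPseudoRiemannianMetric.IsKillingFieldOn K U) {y : 𝓑.carrier} (hy : y ∈ U)
    (hKY : 𝓑.metric.val y (K y) (𝓑.timeOrientation.vectorField y) ≠ 0) :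
    ContMDiffAt (𝓡 4) 𝓘(ℝ, ℝ) ∞ (collarKap 𝓑 K) y := by
  set g := 𝓑.metric.toPseudoRiemannianMetric with hgdef
  have hY := 𝓑.timeOrientation.contMDiff
  have hcov : g.leviCivita.IsLocallyContMDiff ∞ :=
    g.isLocallyContMDiff_leviCivita_holds ⊤ (by exact_mod_cast le_top)
  have h1 : ContMDiffAt (𝓡 4) ((𝓡 4).prod 𝓘(ℝ, E4 →L[ℝ] E4)) ∞ (g.leviCivita.totalCovDeriv K) y :=
    (((hcov U hU).contMDiff hKon.1) y hy).contMDiffAt (hU.mem_nhds hy)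
  have h2 : ContMDiffAt (𝓡 4) (𝓡 4).tangent ∞
      (fun z ↦ (⟨z, 𝓑.metric.leviCivita K z (𝓑.timeOrientation.vectorField z)⟩ :
        TangentBundle (𝓡 4) 𝓑.carrier)) y := h1.clm_bundle_apply (hY y)
  have hK : ContMDiffAt (𝓡 4) (𝓡 4).tangent ∞
      (fun z ↦ (⟨z, K z⟩ : TangentBundle (𝓡 4) 𝓑.carrier)) y := hKon.contMDiffAt hU hy
  have hnum : ContMDiffAt (𝓡 4) 𝓘(ℝ, ℝ) ∞
      (fun z ↦ 𝓑.metric.val z (𝓑.metric.leviCivita K z (𝓑.timeOrientation.vectorField z)) (K z)) y :=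
    g.contMDiffAt_val_apply le_rfl h2 hK
  have hden : ContMDiffAt (𝓡 4) 𝓘(ℝ, ℝ) ∞
      (fun z ↦ 𝓑.metric.val z (K z) (𝓑.timeOrientation.vectorField z)) y :=
    g.contMDiffAt_val_apply le_rfl hK (hY y)
  exact hnum.neg.div₀ hden hKY

/-- **Assembly I: `κ̃` is locally constant on `𝓔⁺` at horizon points where `κ̃ ≠ 0`** (vacuum
collar). -/
theorem eventually_collarKap_eq_of_ne_zero (hvac : 𝓑.metric.toPseudoRiemannianMetric.IsRicciFlat)
    (hU : IsOpen U) (hHU : 𝓑.horizon ⊆ U)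
    (hKon : 𝓑.metric.toPseudoRiemannianMetric.IsKillingFieldOn K U)
    (hKne : ∀ p ∈ 𝓑.horizon, K p ≠ 0) (hnull : ∀ p ∈ 𝓑.horizon, 𝓑.metric.val p (K p) (K p) = 0)
    (hKtl : ∀ x ∈ U ∩ 𝓑.doc, 𝓑.metric.val x (K x) (K x) < 0) {p : 𝓑.carrier} (hp : p ∈ 𝓑.horizon)
    (hkp : collarKap 𝓑 K p ≠ 0) :
    ∀ᶠ q in 𝓝 p, q ∈ 𝓑.horizon → collarKap 𝓑 K q = collarKap 𝓑 K p := by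
  set g := 𝓑.metric.toPseudoRiemannianMetric with hgdef
  set Y : Π x : 𝓑.carrier, TangentSpace (𝓡 4) x := 𝓑.timeOrientation.vectorField with hYdef
  set F : Set 𝓑.carrier := 𝓑.metric.chronologicalFuture 𝓑.timeOrientation 𝓑.Mext with hFdef
  have hFopen : IsOpen F :=
    LorentzianMetric.isOpen_chronologicalFuture_of_boundaryless 𝓑.metric 𝓑.timeOrientation _
  have hY := 𝓑.timeOrientation.contMDiff
  -- the pointwise law in `κ̃`-form on the horizon
  have hlaw := fun q (hq : q ∈ 𝓑.horizon) ↦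
    leviCivita_self_eq_collarKap_smul 𝓑 hU hHU hKon hKne hnull hKtl hq
  -- the open sub-carrier `W = U ∩ I⁺(M_ext) ∩ {g(K, Y) ≠ 0} ⊇ 𝓔⁺`
  have hKYcont : ContinuousOn (fun y ↦ 𝓑.metric.val y (K y) (Y y)) U := fun y hy ↦
    ((g.contMDiffAt_val_apply le_rfl (hKon.contMDiffAt hU hy) (hY y)).continuousAt).continuousWithinAt
  set W : Set 𝓑.carrier := (U ∩ (fun y ↦ 𝓑.metric.val y (K y) (Y y)) ⁻¹' {0}ᶜ) ∩ F with hWdef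
  have hWopen : IsOpen W := (hKYcont.isOpen_inter_preimage hU isOpen_compl_singleton).inter hFopen
  have hWU : W ⊆ U := fun y hy ↦ hy.1.1
  have hHW : 𝓑.horizon ⊆ W := fun q hq ↦
    ⟨⟨hHU hq, val_timeOrientation_ne_zero_of_null 𝓑 (hnull q hq) (hKne q hq)⟩, hq.2⟩
  -- read on the open submanifold `W`
  set W' : Opens 𝓑.carrier := ⟨W, hWopen⟩ with hW'def
  set gW := (𝓑.metric.restrict PseudoRiemannianMetric.contMDiff_restrict_holds W').toPseudoRiemannianMetric
    with hgWdef
  haveI hgWLC : gW.HasLeviCivita := gW.hasLeviCivita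
  set KW : Π y : W', TangentSpace (𝓡 4) y := fun y ↦ (K y.1 : TangentSpace (𝓡 4) y) with hKWdef
  set kW : W' → ℝ := fun y ↦ collarKap 𝓑 K y.1 with hkWdef
  set fW : W' → ℝ := fun y ↦ gW.val y (KW y) (KW y) with hfWdef
  set SW : Set W' := Subtype.val ⁻¹' 𝓑.horizon with hSWdef
  have hKW : gW.IsKillingField KW := isKillingField_restrict_of_isKillingFieldOn 𝓑 W' hU hWU hKon
  have hvacW : gW.IsRicciFlat := isRicciFlat_restrict_of_isRicciFlat 𝓑 W' hvac
  have hvalW : ∀ (y : W') (v w : TangentSpace (𝓡 4) y), gW.val y v w = 𝓑.metric.val y.1 v w :=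
    fun _ _ _ ↦ rfl
  have hLCW : ∀ (y : W') (v : TangentSpace (𝓡 4) y),
      gW.leviCivita KW y v = 𝓑.metric.leviCivita K y.1 v := fun y v ↦
    leviCivita_restrict_apply_of_mdifferentiableAt 𝓑 W' y (hKon.mdifferentiableAt hU (hWU y.2)) v
  -- smoothness of `kW` and of `fW` everywhere on `W'`
  have hkW : ∀ y : W', ContMDiffAt (𝓡 4) 𝓘(ℝ, ℝ) ∞ kW y := fun y ↦
    (contMDiffAt_collarKap 𝓑 hU hKon (hWU y.2) y.2.1.2).comp y (contMDiff_subtype_val y)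
  have hfWs : ∀ y : W', ContMDiffAt (𝓡 4) 𝓘(ℝ, ℝ) ∞ fW y := fun y ↦
    gW.contMDiffAt_val_apply le_rfl (hKW.contMDiff y) (hKW.contMDiff y)
  -- the pointwise law, read on `W'`
  have hlawW : ∀ y : W', y ∈ SW → fW y = 0 ∧
      ∀ v, gW.val y (gW.leviCivita KW y v) (KW y) = -(kW y) * gW.val y (KW y) v := by
    intro y hy
    refine ⟨?_, fun v ↦ ?_⟩
    · change 𝓑.metric.val y.1 (K y.1) (K y.1) = 0
      exact hnull _ hy
    · rw [hLCW]
      exact (hlaw y.1 hy).2 v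
  -- `dfW_y = -2 κ̃(y) g(K, ·)` on `SW`, hence `≠ 0` where `κ̃ ≠ 0`
  have hdfW : ∀ y : W', y ∈ SW → ∀ v,
      mvfderiv (𝓡 4) fW y v = -(2 * kW y) * 𝓑.metric.val y.1 (K y.1) v := by
    intro y hy v
    rw [hKW.mvfderiv_val_self_apply y v, (hlawW y hy).2 v]
    change 2 * (-(kW y) * 𝓑.metric.val y.1 (K y.1) v) = _
    ring
  have hdfW_ne : ∀ y : W', y ∈ SW → kW y ≠ 0 → mvfderiv (𝓡 4) fW y ≠ 0 := by
    intro y hy hky h0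
    have h := hdfW y hy (Y y.1)
    rw [h0, zero_apply] at h
    exact val_timeOrientation_ne_zero_of_null 𝓑 (hnull _ hy) (hKne _ hy)
      ((mul_eq_zero.mp h.symm).resolve_left (neg_ne_zero.mpr (mul_ne_zero two_ne_zero hky)))
  -- step B, transported: near horizon points with `κ̃ ≠ 0` the zeros of `fW` lie in `SW`
  have hlevelW : ∀ y : W', y ∈ SW → kW y ≠ 0 → ∀ᶠ z in 𝓝 y, fW z = 0 → z ∈ SW := by
    intro y hy hky
    have hB := eventually_mem_horizon_of_val_self_eq_zero 𝓑 hU hHU hKon hnull hKtl hy hky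
      (hlaw y.1 hy).1 (hKne _ hy)
    exact (continuous_subtype_val.continuousAt.eventually hB : _)
  -- the point `p`, read on `W'`
  set pW : W' := ⟨p, hHW hp⟩ with hpWdef
  have hpS : pW ∈ SW := hp
  -- `kW` is continuous at `pW`, so `kW ≠ 0` near `pW`
  have hkne : ∀ᶠ y in 𝓝 pW, kW y ≠ 0 := (hkW pW).continuousAt.eventually_ne hkp
  -- step E4 + kernel inclusion: `dkW_q ∈ ℝ dfW_q` at horizon points `q` near `pW`
  have hpropW : ∀ᶠ q in 𝓝 pW, fW q = fW pW → ∃ μ : ℝ, mvfderiv (𝓡 4) kW q = μ • mvfderiv (𝓡 4) fW q := by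
    filter_upwards [hkne, hlevelW pW hpS hkp] with q hkq hlq hfq
    have hfp : fW pW = 0 := (hlawW pW hpS).1
    rw [hfp] at hfq
    have hqS : q ∈ SW := hlq hfq
    -- E4 at `q`
    have hE4 : ∀ X : TangentSpace (𝓡 4) q, mvfderiv (𝓡 4) fW q X = 0 → mvfderiv (𝓡 4) kW q X = 0 := by
      intro X hX
      refine mvfderiv_kap_eq_zero (g := gW) hKW (Eventually.of_forall fun y ↦ hkW y) hqS
        (hlevelW q hqS hkq) (Eventually.of_forall fun y hy ↦ hlawW y hy) hkq
        (hKne _ hqS) hX ?_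
      have := hvacW q
      rw [this]
      rfl
    obtain ⟨c, hc⟩ := exists_eq_mul_of_ker_le (x := q)
      (mvfderiv (𝓡 4) fW q : TangentSpace (𝓡 4) q →ₗ[ℝ] ℝ)
      (mvfderiv (𝓡 4) kW q : TangentSpace (𝓡 4) q →ₗ[ℝ] ℝ) (fun z hz ↦ hE4 z hz)
    exact ⟨c, ContinuousLinearMap.ext fun v ↦ by rw [smul_apply, smul_eq_mul]; exact hc v⟩
  -- step G on `W'`
  have hG := eventually_eq_of_mvfderiv_eq_smul_on_levelSet (I := 𝓡 4)
    (Eventually.of_forall fun q ↦ (hfWs q).of_le (by exact_mod_cast le_top))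
    (Eventually.of_forall fun q ↦ (hkW q).of_le (by exact_mod_cast le_top))
    (hdfW_ne pW hpS hkp) hpropW
  -- back to `𝓑`
  have hmap : map (Subtype.val : W' → 𝓑.carrier) (𝓝 pW) = 𝓝 p :=
    (W'.isOpenEmbedding'.map_nhds_eq pW)
  have hG' : ∀ᶠ q in 𝓝 pW, (q.1 ∈ 𝓑.horizon → collarKap 𝓑 K q.1 = collarKap 𝓑 K p) := by
    filter_upwards [hG] with q hq hqH
    have hf0 : fW q = fW pW := by rw [(hlawW q hqH).1, (hlawW pW hpS).1]
    exact hq hf0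
  rw [← hmap, eventually_map]
  exact hG'

end Local


/-! ## The collar zeroth law -/

section Global

variable (𝓑 : StationaryAFBlackHole.{0}) [𝓑.metric.HasLeviCivita]
  {U : Set 𝓑.carrier} {K : Π x : 𝓑.carrier, TangentSpace (𝓡 4) x}

/-- **The zeroth law of black-hole mechanics for a Killing–timelike collar (vacuum), PROVED.**
Let `𝓑` be a vacuum stationary black-hole presentation with connected horizon `𝓔⁺`, and `K` a
Killing field on an open `U ⊇ 𝓔⁺`, nowhere zero and null on `𝓔⁺` and timelike on the collar
`U ∩ ⟨⟨M_ext⟩⟩`.  Then `∇_K K = κ K` on `𝓔⁺` with ONE constant `κ`.  Proof: `κ̃ = collarKap` works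
pointwise (step A); it is continuous on `𝓔⁺` and locally constant at the points where it is
non-zero (assembly I), so on the connected `𝓔⁺` the set `{κ̃ = c}` for a non-zero value `c` is
clopen and non-empty, hence everything — or `κ̃ ≡ 0`.  Bardeen–Carter–Hawking 1973, §3;
Wald 1984, §12.5, (12.5.31). -/
theorem vacuumHorizonZerothLaw_of_collar (hvac : 𝓑.metric.toPseudoRiemannianMetric.IsRicciFlat)
    (hconn : IsConnected 𝓑.horizon) (hU : IsOpen U) (hHU : 𝓑.horizon ⊆ U)
    (hKon : 𝓑.metric.toPseudoRiemannianMetric.IsKillingFieldOn K U)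
    (hKne : ∀ p ∈ 𝓑.horizon, K p ≠ 0) (hnull : ∀ p ∈ 𝓑.horizon, 𝓑.metric.val p (K p) (K p) = 0)
    (hKtl : ∀ x ∈ U ∩ 𝓑.doc, 𝓑.metric.val x (K x) (K x) < 0) :
    ∃ κ : ℝ, ∀ p ∈ 𝓑.horizon, 𝓑.metric.leviCivita K p (K p) = κ • K p := by
  have hlaw := fun q (hq : q ∈ 𝓑.horizon) ↦
    leviCivita_self_eq_collarKap_smul 𝓑 hU hHU hKon hKne hnull hKtl hq
  haveI : ConnectedSpace 𝓑.horizon := isConnected_iff_connectedSpace.mp hconn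
  have hcont : Continuous (fun q : 𝓑.horizon ↦ collarKap 𝓑 K q.1) :=
    continuous_iff_continuousAt.mpr fun q ↦
      ((contMDiffAt_collarKap 𝓑 hU hKon (hHU q.2)
        (val_timeOrientation_ne_zero_of_null 𝓑 (hnull _ q.2) (hKne _ q.2))).continuousAt).comp
        continuous_subtype_val.continuousAt
  by_cases hex : ∃ p₀ ∈ 𝓑.horizon, collarKap 𝓑 K p₀ ≠ 0
  · obtain ⟨p₀, hp₀, hc⟩ := hex
    set c := collarKap 𝓑 K p₀ with hcdef
    set A : Set 𝓑.horizon := {q | collarKap 𝓑 K q.1 = c} with hAdef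
    have hAclosed : IsClosed A := isClosed_eq hcont continuous_const
    have hAopen : IsOpen A := by
      rw [isOpen_iff_mem_nhds]
      intro q hq
      have hqc : collarKap 𝓑 K q.1 = c := hq
      have hq' : collarKap 𝓑 K q.1 ≠ 0 := by rw [hqc]; exact hc
      have hloc := eventually_collarKap_eq_of_ne_zero 𝓑 hvac hU hHU hKon hKne hnull hKtl q.2 hq'
      have hloc' : ∀ᶠ y : 𝓑.horizon in 𝓝 q, (y.1 ∈ 𝓑.horizon →
          collarKap 𝓑 K y.1 = collarKap 𝓑 K q.1) :=
        continuous_subtype_val.continuousAt.eventually hloc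
      filter_upwards [hloc'] with y hy
      show collarKap 𝓑 K y.1 = c
      rw [hy y.2, hqc]
    have hAuniv : A = univ := IsClopen.eq_univ ⟨hAclosed, hAopen⟩ ⟨⟨p₀, hp₀⟩, rfl⟩
    refine ⟨c, fun p hp ↦ ?_⟩
    have hpA : (⟨p, hp⟩ : 𝓑.horizon) ∈ A := by rw [hAuniv]; exact mem_univ _
    have hpc : collarKap 𝓑 K p = c := hpA
    rw [(hlaw p hp).1, hpc]
  · push Not at hex
    refine ⟨0, fun p hp ↦ ?_⟩
    rw [(hlaw p hp).1, hex p hp]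

end Global


/-- **Registered sub-goal form of the collar zeroth law** (closed statement, crux
stmt-FinalStateConjecture-17840): the zeroth law of black-hole mechanics for a Killing–timelike
collar of a vacuum hole with connected horizon — PROVED, replacing the named-fact debt
`VacuumHorizonZerothLaw` in the line's reduction. -/
theorem stub_vacuumHorizonZerothLaw_of_collar : ∀ (𝓑 : StationaryAFBlackHole.{0}) [𝓑.metric.HasLeviCivita] (U : Set 𝓑.carrier) (K : Π x : 𝓑.carrier, TangentSpace (𝓡 4) x), 𝓑.metric.toPseudoRiemannianMetric.IsRicciFlat → IsConnected 𝓑.horizon → IsOpen U → 𝓑.horizon ⊆ U → 𝓑.metric.toPseudoRiemannianMetric.IsKillingFieldOn K U → (∀ p ∈ 𝓑.horizon, K p ≠ 0) → (∀ p ∈ 𝓑.horizon, 𝓑.metric.val p (K p) (K p) = 0) → (∀ x ∈ U ∩ 𝓑.doc, 𝓑.metric.val x (K x) (K x) < 0) → ∃ κ : ℝ, ∀ p ∈ 𝓑.horizon, 𝓑.metric.leviCivita K p (K p) = κ • K p :=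
  fun 𝓑 _ _ _ hvac hconn hU hHU hKon hKne hnull hKtl ↦
    vacuumHorizonZerothLaw_of_collar 𝓑 hvac hconn hU hHU hKon hKne hnull hKtl

end Summit.FinalStateConjecture.FinalStateConjecture.Theorems.HawkingExtensionIsKerr.SketchIdeator2

end
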